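/-
Copyright: the b2b-balaban T⁴-continuum CRUX team, row NE7b OWNER lineage `t4-ne7b-p1` (gen 147). Project licence.
-/
import Summits.QuantumFields.BalabanUV.T4Continuum.Spine.NE7b.SupKernelClassThirdOrder
import Summits.QuantumFields.BalabanUV.T4Continuum.Spine.NE7b.SupWeightedFamilyProfiles
import Summits.QuantumFields.BalabanUV.T4Continuum.Spine.NE7b.SupWeightedProfileDischarge

/-!
# THE WEIGHTED CLASS MAP PACKAGED AT ORDER THREE — THE ENTRY FORMAT (SCOPING-d17 (d14)(3) ∕ SCOPING-d18 §E F20; file (764)).  At order 3 the weighted class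
# carries the three full-graph letters of the third-derivative majorant `|U₃(φ)[e_u,e_x,e_y]| ≤ K3_{xyu}`: `Σ_{y,v}K3_{xyv}ϑ₂ϑ₂ϑ₂ ≤ k3rϑ` (`x`
# fixed), `k3mϑ` (`y` fixed), `k3cϑ` (`v` fixed).  (483) put the OUTPUT third derivative `T(ψ)` of `W⁺(ψ) = −log∫e^{−U(·+ψ)}dμ_{AAᵀ}` in the
# input's entry format `|T(ψ)[e_v,e_x,e_y]| ≤ M₃(v;x,y) = K3_{xyv} + E_D(g^{vy},b^x) + E_D(g^{vx},b^y) + E_D(b^v,g^{xy}) + C₃∕(ρ_{vx}ρ_{vy})`; (657)∕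
# (658) summed `M₃` against the OUTPUT full-graph weight `ϑϑϑ` in the three roles GIVEN five profile letters `αθ, αθc, αg1m, αg2m, αg1c`
# (and (483) itself needs the profiles `αθ`, `βθ` of its decay constant `C₃`).  THIS FILE packages the ENTRY FORMAT itself — the next
# member's entrywise majorant `K3⁺ := M₃` — with those two profiles discharged ((659) `hk_profile_row`, (747) `hk_profile_point`):
# `|T(ψ)[e_v,e_x,e_y]| ≤ M₃(v;x,y)` from (483)'s non-profile hypotheses, the INPUT's intrinsic row letter `hrϑ` of `Hk` (at `ϑ₂ ≥ 1`), the
# factor's weighted row letter `Σ_{z′}|A_{uz′}|σA_{uz′} ≤ αrσ` under `σ_{vz′} ≤ ϑ₂(v,u)σA_{uz′}`, and the bookkeeping `hrϑ·αrσ ≤ αθ ≤ βθ` — NO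
# profile hypothesis (row NE7b, node U5c; (483), (659), (747) BY NAME; [folklore]).  Letters: (749); operator: (750).

Cell `pub-balaban`, sub-cell `t4`, spine estimate NE7b (`T4WeightBudget.RelWeightBound`; the cell's OWN estimate — NOT PRINTED in
[Bałaban 1983–89], NOT PROVED).  Crux-route work under `Spine/NE7b/` by the row OWNER (`t4-ne7b-p1` gen 147, file (764)) under FREEZE
(0)'s crux-prover clause; NOTHING of Bałaban's is named as a Lean object, valued or asserted; no `T4Continuum/Support` leaf typed; no
`def`, no notation (`T(ψ)`, `M₃` WRITTEN OUT as printed by (483)); zero `sorry`.  Imports (BY NAME): (483) `…SupKernelClassThirdOrder`,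
(659) `…SupWeightedFamilyProfiles`, (747) `…SupWeightedProfileDischarge`.

WHAT IS PROVED ([folklore]): **`classmap_three_entry`**; toy.

HONEST (what this is NOT).  The order-3 entry format of the packaging (letters (749), operator (750); orders 2, 4, 5: the sibling files); the derivative∕continuity slots of the class
carry no profile letter and are not restated; finite-torus Gaussian measure `μ_{AAᵀ}` with the road's regularisation; rates (672)∕(746);
scalar skeleton ((A3), NC-NE7b-α UNRULED); nothing of Bałaban's asserted.  BY-NAME EFFECT ON THE WALL: NONE.  NE7b NOT PRINTED ∕ NOT
PROVED; spine PROVED 0∕9; rung (B)+1 — the programme's measures remain FINITE-torus statements; NOT the mass gap, NOT Clay.  HONEST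
DEPENDENCY: continuum YM on T⁴ ⇐ BetaPertH ∧ nine spine estimates (0∕9 proved); BetaPertH ⇐ (D1) ∧ (D4) ∧ CAP+tail; G-an2-4 gates asym,
D1 and NE2∕3∕4.
-/

set_option autoImplicit false
set_option maxSynthPendingDepth 3

noncomputable section

namespace Summit.QuantumFields.BalabanUV.T4Continuum.NE7b.SupWeightedClassMapOrderThreeEntry

open MeasureTheory ProbabilityTheory Finset Real Matrix
open scoped BigOperators Matrix
open SupKernelClassThirdOrder (output_third_entry_format)
open SupWeightedFamilyProfiles (hk_profile_row)
open SupWeightedProfileDischarge (hk_profile_point hk_row_of_slot letter_nonneg₁)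

variable {ι κ : Type} [Fintype ι] [DecidableEq ι] [Fintype κ] [DecidableEq κ]

variable {U : EuclideanSpace ℝ ι → ℝ} {U' : EuclideanSpace ℝ ι → EuclideanSpace ℝ ι →L[ℝ] ℝ}
  {U'' : EuclideanSpace ℝ ι → EuclideanSpace ℝ ι →L[ℝ] EuclideanSpace ℝ ι →L[ℝ] ℝ}
  {U₃ : EuclideanSpace ℝ ι → EuclideanSpace ℝ ι →L[ℝ] EuclideanSpace ℝ ι →L[ℝ] EuclideanSpace ℝ ι →L[ℝ] ℝ} {Hk : ι → ι → ℝ} {K3 : ι → ι → ι → ℝ}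
  {A : Matrix ι κ ℝ} {D : κ → κ → ℝ} {γop κ₀ κ₁ κ₂ κ₃ a τ δ θp lam lamA αr αc hr γ dθ dθ' αθ βθ : ℝ} {θ : κ → κ → ℝ}
  {σ σA : ι → κ → ℝ} {ρ ϑ ϑ₂ : ι → ι → ℝ} {αθc αg1m αg2m αg1c αrσ αcσ hrϑ hcϑ k3rϑ k3mϑ k3cϑ Sϑ2 : ℝ}

set_option maxHeartbeats 800000 in
/-- **ORDER 3, THE ENTRY FORMAT — THE WEIGHTED CLASS MAP PACKAGED**: for every background `ψ` and sites `v, x, y`,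
`|T(ψ)[e_v,e_x,e_y]| ≤ M₃(v;x,y)` ((483)'s entrywise majorant `K3⁺`, whose decay constant `C₃` carries the profiles `αθ, βθ`) from the road's
step data, the INPUT's intrinsic row letter `hrϑ` of `Hk` (at `ϑ₂ ≥ 1`), the factor's weighted row letter `αrσ` under `σ_{vz′} ≤ ϑ₂(v,u)σA_{uz′}`,
and the bookkeeping `hrϑ·αrσ ≤ αθ ≤ βθ`; NO profile hypothesis. [folklore] -/
theorem classmap_three_entry [Nonempty κ] (hΓop : (γop • (1 : Matrix ι ι ℝ) - A * Aᵀ).PosSemidef) (Y : Finset ι)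
    (hUd : ∀ φ : EuclideanSpace ℝ ι, HasFDerivAt U (U' φ) φ) (hU'd : ∀ φ : EuclideanSpace ℝ ι, HasFDerivAt U' (U'' φ) φ)
    (hU''d : ∀ φ : EuclideanSpace ℝ ι, HasFDerivAt U'' (U₃ φ) φ) (hU₃c : Continuous U₃) (hκ₀ : 0 ≤ κ₀) (hκ₁ : 0 ≤ κ₁) (ha : 0 ≤ a) (hκ₂ : 0 ≤ κ₂)
    (hκ₃ : 0 ≤ κ₃) (hτ : 0 < τ) (hδ : 0 < δ) (hθ0 : 0 < θp) (hθ1 : θp < 1) (hκθ : (2 * κ₀ * (1 + τ) + 4 * δ) * γop ≤ θp)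
    (hκθw : 2 * κ₀ * (1 + τ) * γop + 4 * δ ≤ θp) (hstab : ∀ φ : EuclideanSpace ℝ ι, -(κ₀ * ∑ x ∈ Y, φ x ^ 2) ≤ U φ)
    (hU'b : ∀ φ : EuclideanSpace ℝ ι, ‖U' φ‖ ≤ κ₁ * (a + ∑ x ∈ Y, φ x ^ 2)) (hU''b : ∀ φ : EuclideanSpace ℝ ι, ‖U'' φ‖ ≤ κ₂)
    (hU₃b : ∀ φ : EuclideanSpace ℝ ι, ‖U₃ φ‖ ≤ κ₃) (hlam : 0 ≤ lam)
    (hUsec : ∀ s : ℝ, 0 ≤ s → s ≤ 1 → ∀ a b : EuclideanSpace ℝ ι, U ((1 - s) • a + s • b) - lam / 2 * (s * (1 - s)) * ∑ i, (a i - b i) ^ 2 ≤ (1 - s)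
      * U a + s * U b) (hρg : lam * γop < 1)
    (hHk : ∀ (φ : EuclideanSpace ℝ ι) (x z : ι), |U'' φ (EuclideanSpace.single z (1 : ℝ)) (EuclideanSpace.single x (1 : ℝ))| ≤ Hk x z)
    (hHk0 : ∀ v u, 0 ≤ Hk v u)
    (hK3 : ∀ (φ : EuclideanSpace ℝ ι) (u x y : ι), |U₃ φ (EuclideanSpace.single u (1 : ℝ)) (EuclideanSpace.single x (1 : ℝ))
      (EuclideanSpace.single y (1 : ℝ))| ≤ K3 x y u) (hhr : ∀ v, ∑ u, Hk v u ≤ hr) (ψ : EuclideanSpace ℝ ι) (hαr : ∀ u, ∑ w, |A u w| ≤ αr)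
    (hαc : ∀ w, ∑ u, |A u w| ≤ αc) (hlamA : ∀ x : κ, ∑ u, ∑ v, |A u x| * |A v x| * Hk v u ≤ lamA) (hlamA1 : lamA < 1)
    (hγ : αc * hr * αr / (1 - lamA) ≤ γ) (hγ1 : γ < 1) (hD : ∀ x y, 0 ≤ D x y)
    (hDC : ∀ x y, (if x = y then (1 : ℝ) else 0) + ∑ z, D x z * ((if y = z then 0 else ∑ u, ∑ v, |A u y| * |A v z| * Hk v u) / (1 - lamA)) ≤ D x y)
    (hθw1 : ∀ z w, 1 ≤ θ z w) (hDr : ∀ z, ∑ w, D z w * θ z w ≤ dθ) (hdθ : 0 ≤ dθ) (hDc : ∀ w, ∑ z, D z w * θ z w ≤ dθ') (hdθ' : 0 ≤ dθ')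
    (hσ0 : ∀ x w, 0 ≤ σ x w) (hσθ : ∀ x z w, σ x w ≤ σ x z * θ z w) (hρ1 : ∀ x y, 1 ≤ ρ x y) (hρsymm : ∀ x y, ρ x y = ρ y x)
    (hρmul : ∀ x y z, ρ x z ≤ ρ x y * ρ y z) (hρσ : ∀ x y w, ρ x y ^ 8 ≤ σ x w * σ y w)
    (hϑ₂1 : ∀ x y, 1 ≤ ϑ₂ x y) (hσA0 : ∀ u z', 0 ≤ σA u z') (hσϑ₂ : ∀ v u z', σ v z' ≤ ϑ₂ v u * σA u z')
    (hAr : ∀ u, ∑ z', |A u z'| * σA u z' ≤ αrσ) (hhrw : ∀ a, ∑ b, ϑ₂ a b * Hk a b ≤ hrϑ) (hαθ : hrϑ * αrσ ≤ αθ) (hαβ : αθ ≤ βθ) (v x y : ι) :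
    |(((∫ ω : EuclideanSpace ℝ ι, exp (-U (ω + ψ)) ∂(multivariateGaussian 0 (A * Aᵀ)))⁻¹ •
            (∫ ω : EuclideanSpace ℝ ι,
              (exp (-U (ω + ψ)) •
                (U₃ (ω + ψ) -
                  (((ContinuousLinearMap.smulRightL ℝ (EuclideanSpace ℝ ι) (EuclideanSpace ℝ ι →L[ℝ] ℝ)) (U' (ω + ψ))).comp (U'' (ω + ψ)) +
                    (((ContinuousLinearMap.smulRightL ℝ (EuclideanSpace ℝ ι) (EuclideanSpace ℝ ι →L[ℝ] ℝ))).comp (U'' (ω + ψ))).flip (U' (ω + ψ))))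
                + (exp (-U (ω + ψ)) • -U' (ω + ψ)).smulRight (U'' (ω + ψ) - (U' (ω + ψ)).smulRight (U' (ω + ψ)))) ∂(multivariateGaussian 0 (A * Aᵀ)))
            +
            ((-((∫ ω : EuclideanSpace ℝ ι, exp (-U (ω + ψ)) ∂(multivariateGaussian 0 (A * Aᵀ))) ^ 2)⁻¹) •
              -(∫ ω : EuclideanSpace ℝ ι, exp (-U (ω + ψ)) • U' (ω + ψ) ∂(multivariateGaussian 0 (A * Aᵀ)))).smulRight
            (∫ ω : EuclideanSpace ℝ ι, exp (-U (ω + ψ)) • (U'' (ω + ψ) - (U' (ω + ψ)).smulRight (U' (ω + ψ))) ∂(multivariateGaussian 0 (A * Aᵀ)))) +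
          (((ContinuousLinearMap.smulRightL ℝ (EuclideanSpace ℝ ι) (EuclideanSpace ℝ ι →L[ℝ] ℝ))
              (((∫ ω : EuclideanSpace ℝ ι, exp (-U (ω + ψ)) ∂(multivariateGaussian 0 (A * Aᵀ))) ^ 2)⁻¹ •
                (∫ ω : EuclideanSpace ℝ ι, exp (-U (ω + ψ)) • U' (ω + ψ) ∂(multivariateGaussian 0 (A * Aᵀ))))).comp
            (∫ ω : EuclideanSpace ℝ ι, exp (-U (ω + ψ)) • (U'' (ω + ψ) - (U' (ω + ψ)).smulRight (U' (ω + ψ))) ∂(multivariateGaussian 0 (A * Aᵀ))) +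
            (((ContinuousLinearMap.smulRightL ℝ (EuclideanSpace ℝ ι) (EuclideanSpace ℝ ι →L[ℝ] ℝ))).comp
              (((∫ ω : EuclideanSpace ℝ ι, exp (-U (ω + ψ)) ∂(multivariateGaussian 0 (A * Aᵀ))) ^ 2)⁻¹ •
                (∫ ω : EuclideanSpace ℝ ι, exp (-U (ω + ψ)) • (U'' (ω + ψ) - (U' (ω + ψ)).smulRight (U' (ω + ψ))) ∂(multivariateGaussian 0 (A * Aᵀ)))
                +
                ((-2 / (∫ ω : EuclideanSpace ℝ ι, exp (-U (ω + ψ)) ∂(multivariateGaussian 0 (A * Aᵀ))) ^ 3) •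
                  -(∫ ω : EuclideanSpace ℝ ι, exp (-U (ω + ψ)) • U' (ω + ψ) ∂(multivariateGaussian 0 (A * Aᵀ)))).smulRight
                (∫ ω : EuclideanSpace ℝ ι, exp (-U (ω + ψ)) • U' (ω + ψ) ∂(multivariateGaussian 0 (A * Aᵀ))))).flip
            (∫ ω : EuclideanSpace ℝ ι, exp (-U (ω + ψ)) • U' (ω + ψ) ∂(multivariateGaussian 0 (A * Aᵀ))))) (EuclideanSpace.single v (1 : ℝ))
        (EuclideanSpace.single x (1 : ℝ)) (EuclideanSpace.single y (1 : ℝ))| ≤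
        (K3 x y v + ∑ w, (∑ z', D z' w * ∑ u, |A u z'| * K3 v y u) * (∑ z', D z' w * ∑ u, |A u z'| * Hk x u) / (1 - lamA) + ∑ w,
          (∑ z', D z' w * ∑ u, |A u z'| * K3 v x u) * (∑ z', D z' w * ∑ u, |A u z'| * Hk y u) / (1 - lamA) + ∑ w,
          (∑ z', D z' w * ∑ u, |A u z'| * Hk v u) * (∑ z', D z' w * ∑ u, |A u z'| * K3 x y u) / (1 - lamA) + 4 * Real.sqrt
          (5 * (κ₂ ^ 4 * γop ^ 2) / (1 - lam * γop) ^ 2 * (αθ * dθ * (βθ * dθ') / (1 - lamA))) / (ρ v x * ρ v y)) := by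
  have hϑ₂0 : ∀ a b, 0 ≤ ϑ₂ a b := fun a b => zero_le_one.trans (hϑ₂1 a b)
  have hαrσ : 0 ≤ αrσ := (sum_nonneg fun z' _ => mul_nonneg (abs_nonneg _) (hσA0 v z')).trans (hAr v)
  have hhr0 : 0 ≤ hrϑ := letter_nonneg₁ (fun b => mul_nonneg (hϑ₂0 v b) (hHk0 v b)) (hhrw v)
  have haσX : ∀ v, ∑ z', (∑ u, |A u z'| * Hk v u) * σ v z' ≤ αθ := fun v =>
    (hk_profile_row hHk0 hϑ₂0 hσϑ₂ hAr hαrσ (hk_row_of_slot hhrw) v).trans hαθ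
  have hβX : 0 ≤ βθ := ((mul_nonneg hhr0 hαrσ).trans hαθ).trans hαβ
  have haσ'X : ∀ (v : ι) (w : κ), (∑ u, |A u w| * Hk v u) * σ v w ≤ βθ := fun v w => (hk_profile_point hHk0 hσ0 haσX v w).trans hαβ
  exact output_third_entry_format hΓop Y hUd hU'd hU''d hU₃c hκ₀ hκ₁ ha hκ₂ hκ₃ hτ hδ hθ0 hθ1 hκθ hκθw hstab hU'b hU''b hU₃b hlam hUsec hρg hHk hHk0
      hK3 hhr ψ hαr hαc hlamA hlamA1 hγ hγ1 hD hDC hθw1 hDr hdθ hDc hdθ' hσ0 hσθ hρ1 hρsymm hρmul hρσ haσX hβX haσ'X v x y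

/-! ## Toy -/

/-- Toy (the bookkeeping in numbers): with `k3rϑ = 2`, `αrσ = 3` any `αg1m ≥ 6` serves. -/
example : (2 : ℝ) * 3 ≤ 7 := by norm_num

end Summit.QuantumFields.BalabanUV.T4Continuum.NE7b.SupWeightedClassMapOrderThreeEntry

end
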